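import Literature.NumberTheory.ComplexMultiplication.EllipticUnits.KatoEllipticZetaElement
import Literature.NumberTheory.EllipticCurves.Kato2004.IwasawaCohomology
import Literature.NumberTheory.EllipticCurves.KatoFineSelmerDual
import Literature.NumberTheory.EllipticCurves.IwasawaAlgebraInvolution
import Mathlib.RingTheory.QuotSMulTop
import HarnessLib

/-!
# Kato's descent — file 6a (Defs): the TRANSPORT SOCKET (hypothesis structure only; the consumer theorem is file 6b `…KatoDescentSocket.lean`). Clause (g)^ι of 26471's registered stub `stub_coreLowerCMTwo`
# from ONE hypothesis structure = Kato Lemma 15.13 (1)/(15.13.1)/(15.13.2) + (15.16.1) + §15.15 relative to the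
# pinned K-side tower `D : Kato2004.EllipticUnitTower` and the pinned ℚ-side `𝐇¹_Γ(T₂A)`, `X₀(A/ℚ_∞)`

Helper file for crux K2R0P♭ `stmt-BirchSwinnertonDyer-26471`
(`Summit.BirchSwinnertonDyer.BirchSwinnertonDyer.Theses.ThetaPartnerAtTwo.SignedMainConjectureCMTwoRankZeroOfPubOfFlat`,
route `ThetaPartnerAtTwo`, line `rankzero` v17 — ONE registered stub `stub_coreLowerCMTwo` = (CORE♭-lower), whose last conjunct is
(g)^ι `lengthAt Λ (I.H ⧸ Λ∙s) 𝔭′ ≤ lengthAt Λ Y.X (ι𝔭′)`; lead prover bsd-wall-tp2-p2 g9, 2026-08-28). BSD is not proved by any of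
this; nothing is asserted (the structure below is a HYPOTHESIS structure — a socket —, the theorem an implication).

WHY A SOCKET. Files 1–5 of this series proved every piece of ALGEBRA between the printed K-tower equality (Johnson-Leung–Kings 2011
Thm. 5.7 / §7.2, typed: `ZetaSkeleton.Thm57RegularShape` on `D.toZetaSkeleton`, transported to `A = Λ_𝔮` by the typer's
`thm57RegularShape_lengthAt_atPrime_eq_of_not_mem`) and clause (g)^ι: Kato's Lemma 14.15 (file 2), the descent inequality and its K-side
composition (files 3–4), the ℚ-side Thm. 12.4 (2) discharge and the length adapters (file 5). What is NOT in the tree is Kato's Lemma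
15.13 itself — the comparison between the K-tower modules localised at `𝔮 = π⁻¹𝔭′` and Kato's cyclotomic `𝐇^q(T~)_{𝔭′}` — nor (15.16.1)
(the elliptic zeta element maps to Kato's zeta element of `f_A`) nor the Poitou–Tate reading `𝐇²(T~) ↔ X₀`: these need carriers the tree
does not have (corestriction along `ℚ_n ⊂ K(ζ_{2^{n+2}}) ⊂ K(2^{n+2}𝔣)`, the `ψ`-twist, an `O_K`-action on `T₂A`; typer design
bsd-inputs-er2-ty1 evidence #26 §B on 24945, recommended unit «CyclotomicTransport»). `CycTransportSocket` lists EXACTLY the statements such a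
unit must deliver, as fields RELATIVE TO the pinned objects (`D`, `I : Kato2004.IwasawaH1Data A 2 κ γ`, `Y : A.FineSelmerDualData κ γ`, a
class `s ∈ 𝐇¹_Γ(T₂A)`), in the currency consumed by files 3–5; and `lengthAt_quotient_span_le_of_cycTransportSocket` PROVES that any
inhabitant yields (g)^ι for `(I, Y, s, 𝔭′)`. Field ↔ print: `isNoetherianRing/isDomain/krullDimLE/height_ne_one/a/a_mem/φ/φ_surjective/
ker_φ` = Lemma 15.13 (1) ("`O_λ⟦G_{p^∞𝔣}⟧_𝔮` and `O_λ⟦G_∞⟧_𝔭` are regular; the kernel … is a principal ideal `(a)`", with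
`A/aA ≅ O_λ⟦G_∞⟧_𝔭 → Λ_{𝔭′}` the `Δ`-projection reading, flag Kato-134-two-Delta of `Kato2004/EulerSystemBoundFineSelmerTwo`);
`torsH` = §15.1 ("`𝔥¹` is torsion free") at `𝔮`; `ι/ι_smul/ker_ι/length_coker_le` = (15.13.2) (`0 → H¹_𝔮/aH¹_𝔮 → 𝐇¹(T~)_𝔭 → H²_𝔮[a] → 0`);
`ι_ell/s_ne_zero` = (15.16.1) + §15.15 (the image of `z_{p^∞𝔣}` is Kato's zeta element, non-zero); `length_quot_le/length_quot_ne_top` =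
(15.13.1) (`H²_𝔮/aH²_𝔮 ≅ 𝐇²(T~)_𝔭`) read with Thm. 12.4 (1) (torsion ⟹ finite length) and the Poitou–Tate reading `𝐇²(T~)_{𝔭′} ↔ X₀_{ι𝔭′}`
off `(2)` (flag Kato-134-H20-fine; Thm. 12.5 (3): no local `𝐇²` term for `f` potentially good at `p`). HONEST LIMIT: the structure does
NOT express that `D` is the elliptic-unit tower of the CM field and conductor OF `A` (no Grössencharacter in the tree): it is a socket, to
be inhabited only by a faithful construction; an inhabitant for unrelated `(D, A)` would be junk — nothing here asserts one exists.

## References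
* K. Kato, Astérisque 295 (2004), §15.1 (p. 251), Thm. 12.4–12.5 (pp. 221–222), Lemma 14.15 (pp. 243–244), Lemma 15.13, §15.15,
  (15.16.1), Prop. 15.17 (pp. 264–265).
* J. Johnson-Leung, G. Kings, J. reine angew. Math. 653 (2011), Thm. 5.7, §7.2.
-/

set_option autoImplicit false
set_option linter.dupNamespace false

noncomputable section

open scoped Classical Pointwise NumberField

namespace Summit.BirchSwinnertonDyer.BirchSwinnertonDyer.Theorems.KatoDescent

open Literature.NumberTheory.EllipticCurves Literature.NumberTheory.EllipticCurves.Module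
  Literature.NumberTheory.EllipticCurves.Kato2004 Literature.NumberTheory.GaloisRepresentations Field
  Literature.NumberTheory.ComplexMultiplication.EllipticUnits
open Literature.NumberTheory.ComplexMultiplication.EllipticUnits.Kato2004 (EllipticUnitTower)

section Socket

variable {K : Type} [Field K] [NumberField K] {𝔣 : Ideal (𝓞 K)} {ι₀ : K →+* ℂ}
  {A : WeierstrassCurve ℚ} [A.IsElliptic] [ContinuousSMul ℤ_[2] (A.tateModule 2)]
  {κ : ZpExtension ℚ 2} {γ : absoluteGaloisGroup ℚ}

/-- **The transport socket = Kato Lemma 15.13 (1)/(15.13.1)/(15.13.2) + (15.16.1) + §15.15, RELATIVE to the pinned K-side tower `D`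
(at the prime `𝔮` of `Λ_K = D.Λ`, with Kato's `𝔥²`-module `H2` and an admissible twist `𝔞`) and the pinned ℚ-side `I = 𝐇¹_Γ(T₂A)`,
`Y = X₀(A/ℚ_∞)`, a class `s ∈ 𝐇¹_Γ(T₂A)` and a height-one prime `𝔭′` of `Λ = ℤ₂⟦T⟧`** (hypothesis structure; see the module
docstring for field ↔ print; nothing asserted, existence not asserted). Write `A_𝔮 = Λ_{K,𝔮}` (`Localization.AtPrime 𝔮.asIdeal`),
`H_𝔮 = (𝔥¹)_𝔮`, `M_𝔮 = (𝔥²)_𝔮`, `W = (𝐇¹_Γ(T₂A))_{𝔭′}`.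
[cite: Kato2004Asterisque, Lemma 15.13 (p. 264), §15.15 and (15.16.1) (p. 265), §15.1 (p. 251), Thm. 12.4 (1) and Thm. 12.5 (3) (pp. 221–222)] -/
structure CycTransportSocket (D : EllipticUnitTower K 2 𝔣 ι₀) (𝔮 : PrimeSpectrum D.Λ) (𝔞 : Ideal (𝓞 K))
    (H2 : Type) [AddCommGroup H2] [Module D.Λ H2]
    (I : IwasawaH1Data A 2 κ γ) (Y : A.FineSelmerDualData κ γ) (s : I.H)
    (𝔭' : PrimeSpectrum (IwasawaAlgebra 2)) : Type where
  /-- `p = 2 ∉ 𝔮` (Kato: `𝔭′ ∌ p`, and `𝔮 = π⁻¹𝔭′`). -/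
  two_not_mem : ((2 : ℕ) : D.Λ) ∉ 𝔮.asIdeal
  /-- `𝔞` is an admissible twist (`(𝔞, 6p𝔣) = 1`, `𝔞 ≠ O_K`) … -/
  isTwist : IsTwist 2 𝔣 𝔞
  /-- … with `N(𝔞) − σ_𝔞 ∉ 𝔮`, so that `A_𝔮·z_{p^∞𝔣} = A_𝔮·(_𝔞z)_n` ((15.6.4)). -/
  nsub_not_mem : D.nsub 𝔞 ∉ 𝔮.asIdeal
  /-- Lemma 15.13 (1): `A_𝔮` is Noetherian … -/
  isNoetherianRing : IsNoetherianRing (Localization.AtPrime 𝔮.asIdeal)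
  /-- … a domain (regular local) … -/
  isDomain : IsDomain (Localization.AtPrime 𝔮.asIdeal)
  /-- … of dimension `≤ 2` … -/
  krullDimLE : Ring.KrullDimLE 2 (Localization.AtPrime 𝔮.asIdeal)
  /-- … and exactly `2` where it matters: `ht 𝔪 ≠ 1`. -/
  height_ne_one : (IsLocalRing.maximalIdeal (Localization.AtPrime 𝔮.asIdeal)).height ≠ 1
  /-- Lemma 15.13 (1): a generator `a` of the kernel of `A_𝔮 → O_λ⟦G_∞⟧_𝔭 (→ Λ_{𝔭′})` … -/
  a : Localization.AtPrime 𝔮.asIdeal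
  /-- … in the maximal ideal. -/
  a_mem : a ∈ IsLocalRing.maximalIdeal (Localization.AtPrime 𝔮.asIdeal)
  /-- The ring map `A_𝔮 → Λ_{𝔭′}` (Lemma 15.13 (1) with the `Δ`-projection `O_λ⟦G_∞⟧ → Λ`) … -/
  φ : Localization.AtPrime 𝔮.asIdeal →+* Localization.AtPrime 𝔭'.asIdeal
  /-- … surjective … -/
  φ_surjective : Function.Surjective φ
  /-- … with kernel inside `(a)` ("the kernel … is a principal ideal", generated by `a`). -/
  ker_φ : ∀ b, φ b = 0 → b ∈ Ideal.span {a}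
  /-- §15.1 at `𝔮`: `(𝔥¹)_𝔮` has no `a`-torsion ("`𝔥¹` is torsion free"). -/
  torsH : Submodule.torsionBy (Localization.AtPrime 𝔮.asIdeal) (LocalizedModule 𝔮.asIdeal.primeCompl D.H) a = ⊥
  /-- (15.13.2): the map `H¹_𝔮 → 𝐇¹(T~)_𝔭 = W` (additive, `φ`-semilinear) … -/
  ι : LocalizedModule 𝔮.asIdeal.primeCompl D.H →+ LocalizedModule 𝔭'.asIdeal.primeCompl I.H
  /-- … `φ`-semilinear … -/
  ι_smul : ∀ (b : Localization.AtPrime 𝔮.asIdeal) (x : LocalizedModule 𝔮.asIdeal.primeCompl D.H), ι (b • x) = φ b • ι x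
  /-- … with kernel exactly `a·H¹_𝔮` (exactness of (15.13.2) at `H¹_𝔮/aH¹_𝔮`) … -/
  ker_ι : ∀ x : LocalizedModule 𝔮.asIdeal.primeCompl D.H,
    ι x = 0 ↔ x ∈ a • (⊤ : Submodule (Localization.AtPrime 𝔮.asIdeal) (LocalizedModule 𝔮.asIdeal.primeCompl D.H))
  /-- … and cokernel `≅ H²_𝔮[a]` (exactness of (15.13.2) at `𝐇¹(T~)_𝔭`), in lengths. -/
  length_coker_le : Module.length (Localization.AtPrime 𝔭'.asIdeal)
      (LocalizedModule 𝔭'.asIdeal.primeCompl I.H ⧸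
        Submodule.span (Localization.AtPrime 𝔭'.asIdeal) (Set.range ι)) ≤
    Module.length (Localization.AtPrime 𝔮.asIdeal)
      (Submodule.torsionBy (Localization.AtPrime 𝔮.asIdeal) (LocalizedModule 𝔮.asIdeal.primeCompl H2) a)
  /-- (15.16.1): the elliptic zeta element maps to the class `s` (Kato's zeta element of `f_A`) … -/
  ι_ell : ι (LocalizedModule.mkLinearMap 𝔮.asIdeal.primeCompl D.H (D.ell 𝔞)) =
    LocalizedModule.mkLinearMap 𝔭'.asIdeal.primeCompl I.H s
  /-- … which is non-zero (§15.15, from 13.5 and (15.12.2): an `L`-value does not vanish). -/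
  s_ne_zero : s ≠ 0
  /-- (15.13.1) `H²_𝔮/aH²_𝔮 ≅ 𝐇²(T~)_𝔭`, read with the Poitou–Tate identification off `(2)` and Thm. 12.5 (3) (no local `𝐇²` term at good
  reduction) against the pinned fine dual at the involuted prime: `ℓ_{A_𝔮}(H²_𝔮/aH²_𝔮) ≤ ℓ_{ι𝔭′}(X₀)` … -/
  length_quot_le : Module.length (Localization.AtPrime 𝔮.asIdeal) (QuotSMulTop a (LocalizedModule 𝔮.asIdeal.primeCompl H2)) ≤
    lengthAt (IwasawaAlgebra 2) Y.X (PrimeSpectrum.comap (IwasawaAlgebra.invol 2).toRingHom 𝔭')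
  /-- … and finite (Thm. 12.4 (1): `𝐇²(T~)` is torsion). -/
  length_quot_ne_top : Module.length (Localization.AtPrime 𝔮.asIdeal) (QuotSMulTop a (LocalizedModule 𝔮.asIdeal.primeCompl H2)) ≠ ⊤


/-- **Everything K-side, bundled: the datum a «CyclotomicTransport» construction hands to the crux** (appended, lead g9; hypothesis
structure, nothing asserted, existence not asserted). For the pinned ℚ-side `I = 𝐇¹_Γ(T₂A)`, `Y = X₀(A/ℚ_∞)`, a class `s ∈ 𝐇¹_Γ(T₂A)`
and a height-one prime `𝔭′`: an imaginary quadratic set-up `(K, 𝔣, ι₀)`, Kato's elliptic-unit tower `D` of `K(2^∞𝔣)` (typed interface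
`Kato2004.EllipticUnitTower`) with the printed non-zero-divisor clause `hreg` (Kato p. 254), Kato's `𝔥²`-module `H2` (finitely generated
torsion: §15.1, JLK Thm. 5.7 (3)) and `H0`, the K-tower EQUALITY `Thm57RegularShape 2` (Johnson-Leung–Kings 2011 Thm. 5.7 at the regular
primes, §7.2 — NOT `Thm57Shape`, lead ruling R6), the §15.1 review `Section151Shape`, and an inhabitant of the transport socket at some
prime `𝔮` and admissible twist `𝔞`. Consumer: `lengthAt_quotient_span_le_of_kSideDatum` (file 6b) gives clause (g)^ι. HONEST LIMIT as for
`CycTransportSocket`: that `K` is the CM field of `A` and `𝔣` the conductor of its Grössencharacter is NOT expressed (no carrier); a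
faithful construction inhabits this for `(K, 𝔣) = (K_A, 𝔣_ψ)`.
[cite: Kato2004Asterisque, §15.1 (p. 251), §15.6 (p. 254), Lemma 15.13, §15.15, (15.16.1) (pp. 264–265)]
[cite: JohnsonLeungKings2011, Thm. 5.7 and §7.2] -/
structure KSideDatum (I : IwasawaH1Data A 2 κ γ) (Y : A.FineSelmerDualData κ γ) (s : I.H)
    (𝔭' : PrimeSpectrum (IwasawaAlgebra 2)) : Type 1 where
  /-- The imaginary quadratic field (meant: the CM field of `A`). -/
  K : Type
  /-- `K` is a field … -/
  [field : Field K]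
  /-- … and a number field. -/
  [numberField : NumberField K]
  /-- The ideal `𝔣` (meant: the conductor of the Grössencharacter of `A`). -/
  𝔣 : Ideal (𝓞 K)
  /-- The complex embedding of `K`. -/
  ι₀ : K →+* ℂ
  /-- Kato's elliptic-unit tower of `K(2^∞𝔣)` (typed interface). -/
  D : EllipticUnitTower K 2 𝔣 ι₀
  /-- Kato p. 254: `N(𝔞) − σ_𝔞` is a non-zero-divisor for every admissible twist. -/
  hreg : ∀ 𝔞 : EllipticUnitTower.TwistIdeals K 2 𝔣, IsSMulRegular D.Λ (D.nsub 𝔞.1)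
  /-- `𝔥⁰` (consumer's choice; `= 0` by JLK Thm. 5.7 (1)). -/
  H0 : Type
  /-- Kato's `𝔥²`. -/
  H2 : Type
  /-- instances -/
  [addCommGroupH0 : AddCommGroup H0]
  /-- instances -/
  [moduleH0 : Module D.Λ H0]
  /-- instances -/
  [addCommGroupH2 : AddCommGroup H2]
  /-- instances -/
  [moduleH2 : Module D.Λ H2]
  /-- §15.1: `𝔥²` is finitely generated … -/
  finite_H2 : Module.Finite D.Λ H2
  /-- … and torsion. -/
  isTorsion_H2 : Module.IsTorsion D.Λ H2
  /-- Johnson-Leung–Kings 2011 Thm. 5.7 at the REGULAR height-one primes (§7.2), on Kato's skeleton. -/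
  thm57Regular : (D.toZetaSkeleton hreg H0 H2).Thm57RegularShape 2
  /-- Kato §15.1 (review of Rubin): `𝔥¹` f.g., torsion free, rank one at height `0`, `𝔥¹/ℨ` torsion. -/
  section151 : D.Section151Shape
  /-- The prime `𝔮 = π⁻¹𝔭′` of `Λ_K`. -/
  𝔮 : PrimeSpectrum D.Λ
  /-- The admissible twist `𝔞` with `N(𝔞) − σ_𝔞 ∉ 𝔮`. -/
  𝔞 : Ideal (𝓞 K)
  /-- The transport socket (Kato Lemma 15.13, (15.16.1), §15.15) at `(𝔮, 𝔞)`. -/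
  socket : CycTransportSocket D 𝔮 𝔞 H2 I Y s 𝔭'

attribute [instance] KSideDatum.field KSideDatum.numberField KSideDatum.addCommGroupH0 KSideDatum.moduleH0
  KSideDatum.addCommGroupH2 KSideDatum.moduleH2

end Socket

end Summit.BirchSwinnertonDyer.BirchSwinnertonDyer.Theorems.KatoDescent

end
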